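import Summits.Ventures.PercRepro.C041TriangleRayStar

/-!
# UNIVERSAL CERTIFICATES — the rays and the (1,1)-vertex against EVERY cone element, hence EVERY doubly-marked vertex
`X(p,q)`, `p, q ≥ 1`, against every cone element (mine-3, gen 61; C-041.md §21 (ap))

A certificate that is LINEAR in the second zone `w` and built from cone-valued linear maps — multiplication by fixed
leaves, the closure `ℓψ`, and `φ(w)·G` for a functional `φ ≥ 0` on the cone and a fixed generator `G` — holds for every
cone element at once.  THE RAY: `θ_△(e_{T₁}, w) = v 1 * ℓψ(v 1 * w)` exactly (`thetaTri_eT1_eq`; the moment certificate of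
`C041TriangleRayStar` is the decomposition of this closure), so `InCone_thetaTri_eT1 (hw : InCone w)`.  THE (1,1)-VERTEX:
`θ_△(X(1,1), w)` is the explicit combination `thetaTri_X11_universal` of `v ½ * w`, `v ½ * ℓψ(v ½ * v ½ * w)`,
`v ½ * ℓψ(v ½ * w)`, `w`, and the fixed generators `1, v 0, v 1, v ½, X(1,1)` with the coefficients `T₁, T₂, g − k, M₀,
M₁, M₂, I₁, I₂` (all `≥ 0` on the cone: `InCone.coords`) — found as an exact LP over constants (tools/g61/unilp2.py,
symmetrised by the mirror).  THEOREMS: `InCone_thetaTri_X11 (hw : InCone w)`, and by linearity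
**`InCone_thetaTri_marks_any (p q) (hp : 1 ≤ p) (hq : 1 ≤ q) (hw : InCone w) : InCone (thetaTri (v 1 ^ p * v 0 ^ q) w)`**
— every doubly-marked vertex against EVERY cone element — with the cycle corollary `InCone_thetaCyc_marks_any`.
-/

namespace PercRepro

namespace RelaxedTriangle

open TreeClosure Finset

/-- **THE RAY, EXACTLY**: `θ_△(e_{T₁}, w) = v 1 * ℓψ(v 1 * w)` for every six-vector. -/
theorem thetaTri_eT1_eq (w : Vec6) : thetaTri ![0, 1, 0, 0, 0, 0] w = v 1 * ellv (v 1 * w) := by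
  ext i
  simp only [thetaTri_eq_vec, Pi.mul_apply, ellv, ell, v]
  fin_cases i <;> simp [-mul_eq_mul_left_iff, -mul_eq_mul_right_iff] <;> ring

/-- The mirror: `θ_△(e_{T₂}, w) = v 0 * ℓψ(v 0 * w)`. -/
theorem thetaTri_eT2_eq (w : Vec6) : thetaTri ![0, 0, 1, 0, 0, 0] w = v 0 * ellv (v 0 * w) := by
  ext i
  simp only [thetaTri_eq_vec, Pi.mul_apply, ellv, ell, v]
  fin_cases i <;> simp [-mul_eq_mul_left_iff, -mul_eq_mul_right_iff] <;> ring

/-- **THE RAY `e_{T₁}` AGAINST EVERY CONE ELEMENT.** -/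
theorem InCone_thetaTri_eT1 {w : Vec6} (hw : InCone w) : InCone (thetaTri ![0, 1, 0, 0, 0, 0] w) := by
  rw [thetaTri_eT1_eq]
  exact InCone_v1.mul (InCone_ellv (InCone_v1.mul hw))

/-- **THE RAY `e_{T₂}` AGAINST EVERY CONE ELEMENT.** -/
theorem InCone_thetaTri_eT2 {w : Vec6} (hw : InCone w) : InCone (thetaTri ![0, 0, 1, 0, 0, 0] w) := by
  rw [thetaTri_eT2_eq]
  exact InCone_v0.mul (InCone_ellv (InCone_v0.mul hw))

/-- The coordinates of a pure root: `M₀ = M₁ M₂`. -/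
theorem V_three_eq {m : ℕ} (a : Fin m → ℝ) : V a 3 = V a 4 * V a 5 := by
  simp only [V_apply, v]
  simp [Finset.prod_mul_distrib]

/-- The coordinate facts of a cone element: `0 ≤ M₀ ≤ M₁, M₂` (no fewer invalid states of a type than invalid all-red
states), `L₀ ≤ L₁, L₂` (the type counts are non-negative), and `0 ≤ L₀`. -/
theorem InCone_coords {w : Vec6} (hw : InCone w) :
    0 ≤ w 3 ∧ w 3 ≤ w 4 ∧ w 3 ≤ w 5 ∧ w 0 ≤ w 1 ∧ w 0 ≤ w 2 ∧ 0 ≤ w 0 := by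
  induction hw with
  | pure a ha =>
    obtain ⟨h0, h1, h2, h4, h5⟩ := V_coords a
    have hA0 : 0 ≤ V a 4 := by rw [h4]; exact Finset.prod_nonneg (fun i _ => (ha i).1)
    have hA1 : V a 4 ≤ 1 := by rw [h4]; exact Finset.prod_le_one (fun i _ => (ha i).1) (fun i _ => (ha i).2)
    have hB0 : 0 ≤ V a 5 := by rw [h5]; exact Finset.prod_nonneg (fun i _ => by linarith [(ha i).2])
    have hB1 : V a 5 ≤ 1 := by
      rw [h5]; exact Finset.prod_le_one (fun i _ => by linarith [(ha i).2]) (fun i _ => by linarith [(ha i).1])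
    have hP1 : 1 ≤ V a 1 := by rw [h1]; exact Finset.one_le_prod (fun i _ => by nlinarith [sq_nonneg (a i)])
    have hP2 : 1 ≤ V a 2 := by rw [h2]; exact Finset.one_le_prod (fun i _ => by nlinarith [sq_nonneg (1 - a i)])
    have h3 := V_three_eq a
    refine ⟨?_, ?_, ?_, ?_, ?_, ?_⟩
    · rw [h3]; exact mul_nonneg hA0 hB0
    · rw [h3]; nlinarith
    · rw [h3]; nlinarith
    · rw [h0]; exact hP1
    · rw [h0]; exact hP2
    · rw [h0]; exact zero_le_one
  | add _ _ ihx ihy =>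
    simp only [Pi.add_apply]
    exact ⟨by linarith [ihx.1, ihy.1], by linarith [ihx.2.1, ihy.2.1], by linarith [ihx.2.2.1, ihy.2.2.1],
      by linarith [ihx.2.2.2.1, ihy.2.2.2.1], by linarith [ihx.2.2.2.2.1, ihy.2.2.2.2.1],
      by linarith [ihx.2.2.2.2.2, ihy.2.2.2.2.2]⟩
  | smul c hc _ ih =>
    simp only [Pi.smul_apply, smul_eq_mul]
    exact ⟨mul_nonneg hc ih.1, mul_le_mul_of_nonneg_left ih.2.1 hc, mul_le_mul_of_nonneg_left ih.2.2.1 hc,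
      mul_le_mul_of_nonneg_left ih.2.2.2.1 hc, mul_le_mul_of_nonneg_left ih.2.2.2.2.1 hc,
      mul_nonneg hc ih.2.2.2.2.2⟩

/-- **THE UNIVERSAL (1,1)-CERTIFICATE**: `θ_△(X(1,1), w)` as a combination of cone-valued linear maps of `w`, with the
functionals `T₁ = L₁ − L₀`, `T₂ = L₂ − L₀`, `g − k = L₀ − (M₁ + M₂ − M₀)`, `M₀`, `M₁`, `M₂`, `I₁ = M₁ − M₀`, `I₂ = M₂ − M₀`
as coefficients (exact LP over constants, symmetrised; tools/g61/x11uni.py). -/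
theorem thetaTri_X11_universal (w : Vec6) :
    thetaTri (v 1 * v 0) w =
      (8 / 3 : ℝ) • (v (1 / 2) * w) + (32 / 15 : ℝ) • (v (1 / 2) * ellv (v (1 / 2) * v (1 / 2) * w))
      + (8 / 15 : ℝ) • (v (1 / 2) * ellv (v (1 / 2) * w)) + (2 / 3 : ℝ) • w
      + (2 * (w 1 - w 0)) • v 1 + (2 * (w 2 - w 0)) • v 0
      + (4 / 3 * (w 0 - (w 4 + w 5 - w 3))) • (1 : Vec6)
      + (2 / 3 * (w 0 - (w 4 + w 5 - w 3))) • (v 1 + v 0)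
      + (16 / 15 * w 3 + 4 / 5 * (w 4 + w 5 + (w 4 - w 3) + (w 5 - w 3))) • v (1 / 2)
      + (11 / 15 * ((w 4 - w 3) + (w 5 - w 3))) • (1 : Vec6)
      + (1 / 5 * ((w 4 - w 3) + (w 5 - w 3))) • (v 1 * v 0)
      + (1 / 15 * ((w 4 - w 3) + (w 5 - w 3))) • (v 1 + v 0) := by
  ext i
  simp only [thetaTri_eq_vec, Pi.add_apply, Pi.smul_apply, Pi.mul_apply, Pi.one_apply, smul_eq_mul, ellv, ell, v]
  fin_cases i <;> simp <;> ring

/-- **THE (1,1)-VERTEX AGAINST EVERY CONE ELEMENT.** -/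
theorem InCone_thetaTri_X11 {w : Vec6} (hw : InCone w) : InCone (thetaTri (v 1 * v 0) w) := by
  obtain ⟨h3, h34, h35, h01, h02, h0⟩ := InCone_coords hw
  have hk := (K4v_of_InCone hw).k_le_g
  rw [thetaTri_X11_universal]
  have hv1 : InCone (v 1 + v 0) := InCone_v1.add InCone_v0
  refine ((((((((((((InCone.smul _ (by norm_num) (InCone_vh.mul hw)).add
    (InCone.smul _ (by norm_num) (InCone_vh.mul (InCone_ellv ((InCone_vh.mul InCone_vh).mul hw))))).add
    (InCone.smul _ (by norm_num) (InCone_vh.mul (InCone_ellv (InCone_vh.mul hw))))).add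
    (InCone.smul _ (by norm_num) hw)).add
    (InCone.smul _ (by linarith) InCone_v1)).add
    (InCone.smul _ (by linarith) InCone_v0)).add
    (InCone.smul _ (by linarith) InCone_one)).add
    (InCone.smul _ (by linarith) hv1)).add
    (InCone.smul _ (by linarith) InCone_vh)).add
    (InCone.smul _ (by linarith) InCone_one)).add
    (InCone.smul _ (by linarith) (InCone_v1.mul InCone_v0))).add
    (InCone.smul _ (by linarith) hv1))

/-- **EVERY DOUBLY-MARKED VERTEX AGAINST EVERY CONE ELEMENT**: `θ_△(X(p,q), w) ∈ cone` for all `p, q ≥ 1` and all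
`w ∈ cone` — by linearity from the (1,1)-vertex and the two rays. -/
theorem InCone_thetaTri_marks_any (p q : ℕ) (hp : 1 ≤ p) (hq : 1 ≤ q) {w : Vec6} (hw : InCone w) :
    InCone (thetaTri (v 1 ^ p * v 0 ^ q) w) := by
  rw [pow_v_one_mul_pow_v_zero_eq_add p q hp hq, thetaTri_add_left, thetaTri_add_left, thetaTri_smul_left,
    thetaTri_smul_left]
  exact ((InCone_thetaTri_X11 hw).add ((InCone_thetaTri_eT1 hw).smul _ (sh_nonneg p hp))).add
    ((InCone_thetaTri_eT2 hw).smul _ (sh_nonneg q hq))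

/-- The mirror `θ_△(w, X(p,q))`. -/
theorem InCone_thetaTri_any_marks (p q : ℕ) (hp : 1 ≤ p) (hq : 1 ≤ q) {w : Vec6} (hw : InCone w) :
    InCone (thetaTri w (v 1 ^ p * v 0 ^ q)) := by
  rw [thetaTri_comm]
  exact InCone_thetaTri_marks_any p q hp hq hw

/-- **Every two-exit cycle carrying a doubly-marked vertex and ANY cone zone lies in the cone** (any marks `p, q ≥ 1`,
any length and positions). -/
theorem InCone_thetaCyc_marks_any (p₀ q₀ : ℕ) (hp₀ : 1 ≤ p₀) (hq₀ : 1 ≤ q₀) {w : Vec6} (hw : InCone w)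
    {p q s : ℝ} (hp : 0 ≤ p) (hq : 0 ≤ q) (hs : 0 ≤ s) : InCone (thetaCyc p q s (v 1 ^ p₀ * v 0 ^ q₀) w) :=
  InCone_thetaCyc_of_InCone_tri ((InCone_pow_v_one p₀).mul (InCone_pow_v_zero q₀)) hw
    (InCone_thetaTri_marks_any p₀ q₀ hp₀ hq₀ hw) hp hq hs

end RelaxedTriangle

end PercRepro
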